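import Literature.Probability.Process.ConformalStoppedExponential
import HarnessLib

/-!
# The Dambis–Dubins–Schwarz identity for the conformal time change

Fifth file on P. Lévy's conformal invariance of planar Brownian motion (Lawler (2005), Thm. 2.2;
Le Gall (2016), Thm. 5.13 and Thm. 7.19). Let `Ỹ_u = f(X_{α_u})` be the time-changed process and
`σ̃_u = σ_{α_u} (= u ∧ S)` the clock read along the inverse clock (`ConformalTimeChangeDefs`).
Iterating the optional sampling identity `E[G · E^θ_{α_v}] = E[G · E^θ_{α_u}]`
(`ConformalStoppedExponential`) over ordered levels `u₀ ≤ u₁ ≤ ⋯` gives the core of the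
Dambis–Dubins–Schwarz theorem in characteristic-function form:

* `stoppedValue_confExp_div` — `E^θ_{α_v} / E^θ_{α_u} = exp(i Re(θ̄(Ỹ_v − Ỹ_u)) + |θ|²(σ̃_v − σ̃_u)/2)`;
* `measurable_stoppedValue_confExp` (and `_confPos`, `_confClock`) — `𝓕_{α_u}`-measurability of
  the sampled processes;
* `integral_prod_confExp_ratio_eq_one` — **for all `n`,
  `E[∏_{j<n} exp(i Re(θ̄ⱼ(Ỹ_{u_{j+1}} − Ỹ_{u_j})) + |θⱼ|²(σ̃_{u_{j+1}} − σ̃_{u_j})/2)] = 1`**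
  ([Le Gall] proof of Thm. 5.13: the increments of `β = M_{τ_·}` are conditionally Gaussian; here
  before the enlargement, with the random clock increments `σ̃_{u_{j+1}} − σ̃_{u_j}` in place of
  `u_{j+1} − u_j`).

The sequel (`ConformalEnlargement`) adds an independent Brownian motion after the total clock
`S`, turning `σ̃`-increments into deterministic ones, and identifies the law.

## References

* J.-F. Le Gall, *Brownian Motion, Martingales, and Stochastic Calculus* (2016), Thm. 5.13 (proof).
* G. F. Lawler, *Conformally Invariant Processes in the Plane*, AMS (2005), Thm. 2.2.
-/

noncomputable section

open MeasureTheory Filter Topology Set Complex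
open scoped NNReal ENNReal BigOperators ComplexConjugate

namespace Literature.Probability.Process

variable {Ω : Type*} {mΩ : MeasurableSpace Ω} {P : Measure Ω} {W : ℝ≥0 → Ω → (Fin 2 → ℝ)}

namespace IsBrownianVec

variable {x₀ : Fin 2 → ℝ} {U : Set (Fin 2 → ℝ)} {D : Set ℂ} {f : ℂ → ℂ}

/-! ### The sampled processes -/

/-- The exponential process at the inverse clock, in terms of the time-changed process and the
sampled clock: `E^θ_{α_u} = exp(i Re(θ̄ Ỹ_u) + |θ|² σ̃_u / 2)`. [folklore] -/
theorem stoppedValue_confExp (θ : ℂ) (u : ℝ≥0) (ω : Ω) :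
    stoppedValue (confExp θ x₀ W f U) (clockInv x₀ W f U u) ω =
      cexp (I * ((conj θ * tcPos x₀ W f U u ω).re : ℝ) +
        (‖θ‖ ^ 2 * stoppedValue (confClock x₀ W f U) (clockInv x₀ W f U u) ω / 2 : ℝ)) := rfl

/-- The exponential process never vanishes. [folklore] -/
theorem confExp_ne_zero (θ : ℂ) (t : ℝ≥0) (ω : Ω) : confExp θ x₀ W f U t ω ≠ 0 := Complex.exp_ne_zero _

/-- **Ratio of two sampled exponentials**:
`E^θ_{α_v} / E^θ_{α_u} = exp(i Re(θ̄(Ỹ_v − Ỹ_u)) + |θ|²(σ̃_v − σ̃_u)/2)`. [folklore] -/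
theorem stoppedValue_confExp_div (θ : ℂ) (u v : ℝ≥0) (ω : Ω) :
    stoppedValue (confExp θ x₀ W f U) (clockInv x₀ W f U v) ω /
        stoppedValue (confExp θ x₀ W f U) (clockInv x₀ W f U u) ω =
      cexp (I * ((conj θ * (tcPos x₀ W f U v ω - tcPos x₀ W f U u ω)).re : ℝ) +
        (‖θ‖ ^ 2 * (stoppedValue (confClock x₀ W f U) (clockInv x₀ W f U v) ω -
          stoppedValue (confClock x₀ W f U) (clockInv x₀ W f U u) ω) / 2 : ℝ)) := by
  rw [stoppedValue_confExp, stoppedValue_confExp, ← Complex.exp_sub]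
  congr 1
  rw [mul_sub, Complex.sub_re]
  push_cast
  ring

section Measurability

variable (hW : IsBrownianVec W P)

/-- The stopped position, sampled at `α_u`, is `𝓕_{α_u}`-measurable. [folklore] -/
theorem measurable_stoppedValue_confPos (hD : IsOpen D) (hf : DifferentiableOn ℂ f D)
    (hU : IsOpen U) (hUD : closure U ⊆ toC ⁻¹' D) (hx₀ : x₀ ∈ U) (u : ℝ≥0) :
    Measurable[(hW.isStoppingTime_clockInv hD hf hU hUD hx₀ u).measurableSpace]
      (stoppedValue (confPos x₀ W U) (clockInv x₀ W f U u)) := by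
  have hSA : StronglyAdapted hW.natFiltration (confPos x₀ W U) := fun t ↦ hW.stronglyMeasurable_confPos hU t
  have hprog : IsStronglyProgressive hW.natFiltration (confPos x₀ W U) :=
    hSA.isStronglyProgressive_of_continuous fun ω ↦ hW.continuous_confPos ω
  exact measurable_stoppedValue hprog _

/-- The clock, sampled at `α_u`, is `𝓕_{α_u}`-measurable. [folklore] -/
theorem measurable_stoppedValue_confClock (hD : IsOpen D) (hf : DifferentiableOn ℂ f D)
    (hU : IsOpen U) (hUD : closure U ⊆ toC ⁻¹' D) (hx₀ : x₀ ∈ U) (u : ℝ≥0) :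
    Measurable[(hW.isStoppingTime_clockInv hD hf hU hUD hx₀ u).measurableSpace]
      (stoppedValue (confClock x₀ W f U) (clockInv x₀ W f U u)) := by
  have hprog : IsStronglyProgressive hW.natFiltration (confClock x₀ W f U) :=
    (hW.stronglyAdapted_confClock hD hf hU hUD hx₀).isStronglyProgressive_of_continuous
      fun ω ↦ hW.continuous_confClock hD hf hU hUD hx₀ ω
  exact measurable_stoppedValue hprog _

/-- The exponential process, sampled at `α_u`, is `𝓕_{α_u}`-measurable. [folklore] -/
theorem measurable_stoppedValue_confExp (hD : IsOpen D) (hf : DifferentiableOn ℂ f D)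
    (hU : IsOpen U) (hUD : closure U ⊆ toC ⁻¹' D) (hx₀ : x₀ ∈ U) (θ : ℂ) (u : ℝ≥0) :
    Measurable[(hW.isStoppingTime_clockInv hD hf hU hUD hx₀ u).measurableSpace]
      (stoppedValue (confExp θ x₀ W f U) (clockInv x₀ W f U u)) := by
  have hSA : StronglyAdapted hW.natFiltration (confExp θ x₀ W f U) := fun t ↦
    hW.stronglyMeasurable_confExp hD hf hU hUD hx₀ θ (le_refl t)
  have hprog : IsStronglyProgressive hW.natFiltration (confExp θ x₀ W f U) :=
    hSA.isStronglyProgressive_of_continuous fun ω ↦ hW.continuous_confExp hD hf hU hUD hx₀ θ ω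
  exact measurable_stoppedValue hprog _

/-- Monotonicity of the sampled σ-algebras: `𝓕_{α_u} ≤ 𝓕_{α_v}` for `u ≤ v`. [folklore] -/
theorem measurableSpace_clockInv_mono (hD : IsOpen D) (hf : DifferentiableOn ℂ f D)
    (hU : IsOpen U) (hUD : closure U ⊆ toC ⁻¹' D) (hx₀ : x₀ ∈ U) {u v : ℝ≥0} (huv : u ≤ v) :
    (hW.isStoppingTime_clockInv hD hf hU hUD hx₀ u).measurableSpace ≤
      (hW.isStoppingTime_clockInv hD hf hU hUD hx₀ v).measurableSpace :=
  IsStoppingTime.measurableSpace_mono _ _ (clockInv_mono' huv)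

end Measurability

/-! ### Bounds -/

/-- **The sampled clock is `u ∧ S`**, almost surely. [folklore] -/
theorem ae_stoppedValue_confClock_eq [IsProbabilityMeasure P] (hW : IsBrownianVec W P) (hD : IsOpen D)
    (hf : DifferentiableOn ℂ f D) (hU : IsOpen U) (hUb : Bornology.IsBounded U)
    (hUD : closure U ⊆ toC ⁻¹' D) (hx₀ : x₀ ∈ U) :
    ∀ᵐ ω ∂P, ∀ u : ℝ≥0, stoppedValue (confClock x₀ W f U) (clockInv x₀ W f U u) ω =
      min (u : ℝ) (totClock x₀ W f U ω) := by
  filter_upwards [hW.ae_hitTime_ne_top hU hUb hx₀] with ω hρ u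
  obtain ⟨T, hT⟩ := WithTop.ne_top_iff_exists.1 hρ
  have h := hW.confClock_clockInv hD hf hU hUD hx₀ hT.symm u
  rw [stoppedValue, totClock, ← hT]
  exact h

/-- The sampled clock lies in `[0, u]` almost surely (all levels at once). [folklore] -/
theorem ae_stoppedValue_confClock_mem [IsProbabilityMeasure P] (hW : IsBrownianVec W P) (hD : IsOpen D)
    (hf : DifferentiableOn ℂ f D) (hU : IsOpen U) (hUb : Bornology.IsBounded U)
    (hUD : closure U ⊆ toC ⁻¹' D) (hx₀ : x₀ ∈ U) :
    ∀ᵐ ω ∂P, ∀ u : ℝ≥0, stoppedValue (confClock x₀ W f U) (clockInv x₀ W f U u) ω ∈ Icc (0 : ℝ) u := by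
  filter_upwards [hW.ae_stoppedValue_confClock_eq hD hf hU hUb hUD hx₀] with ω hω u
  rw [hω u]
  have hS : 0 ≤ totClock x₀ W f U ω := by
    have := hW.confClock_mono hD hf hU hUD hx₀ ω (show (0 : ℝ≥0) ≤ (hitTime x₀ W Uᶜ ω).untopA from bot_le)
    rwa [confClock_zero] at this
  exact ⟨le_min u.coe_nonneg hS, min_le_left _ _⟩

/-- Norm of the sampled exponential: `exp(|θ|² σ̃_u/2) ∈ [1, exp(|θ|² u/2)]` a.s. [folklore] -/
theorem norm_stoppedValue_confExp (θ : ℂ) (u : ℝ≥0) (ω : Ω) :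
    ‖stoppedValue (confExp θ x₀ W f U) (clockInv x₀ W f U u) ω‖ =
      Real.exp (‖θ‖ ^ 2 * stoppedValue (confClock x₀ W f U) (clockInv x₀ W f U u) ω / 2) :=
  norm_confExp θ _ ω

/-! ### The DDS identity -/

section DDS

variable [IsProbabilityMeasure P]

/-- The product of the sampled exponential ratios over the first `n` level increments. [folklore] -/
theorem integral_prod_confExp_ratio_eq_one (hW : IsBrownianVec W P) (hD : IsOpen D)
    (hf : DifferentiableOn ℂ f D) (hU : IsOpen U) (hUb : Bornology.IsBounded U)
    (hUD : closure U ⊆ toC ⁻¹' D) (hx₀ : x₀ ∈ U) {u : ℕ → ℝ≥0} (hu : Monotone u) (θ : ℕ → ℂ) (n : ℕ) :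
    Integrable (fun ω ↦ ∏ j ∈ Finset.range n,
        stoppedValue (confExp (θ j) x₀ W f U) (clockInv x₀ W f U (u (j + 1))) ω /
          stoppedValue (confExp (θ j) x₀ W f U) (clockInv x₀ W f U (u j)) ω) P ∧
    ∫ ω, ∏ j ∈ Finset.range n,
        stoppedValue (confExp (θ j) x₀ W f U) (clockInv x₀ W f U (u (j + 1))) ω /
          stoppedValue (confExp (θ j) x₀ W f U) (clockInv x₀ W f U (u j)) ω ∂P = 1 := by
  -- abbreviations
  set E : ℕ → ℕ → Ω → ℂ := fun j k ↦ stoppedValue (confExp (θ j) x₀ W f U) (clockInv x₀ W f U (u k)) with hE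
  have hτ := fun k ↦ hW.isStoppingTime_clockInv hD hf hU hUD hx₀ (u k)
  -- measurability of `E j k` w.r.t. `𝓕_{α_{u m}}` for `k ≤ m`
  have hEm : ∀ j k m, k ≤ m → Measurable[(hτ m).measurableSpace] (E j k) := fun j k m hkm ↦
    (hW.measurable_stoppedValue_confExp hD hf hU hUD hx₀ (θ j) (u k)).mono
      (hW.measurableSpace_clockInv_mono hD hf hU hUD hx₀ (hu hkm)) le_rfl
  have hEm' : ∀ j k, Measurable (E j k) := fun j k ↦ (hEm j k k le_rfl).mono (hτ k).measurableSpace_le le_rfl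
  -- a.s. bounds
  have hbd : ∀ᵐ ω ∂P, ∀ j k, 1 ≤ ‖E j k ω‖ ∧ ‖E j k ω‖ ≤ Real.exp (‖θ j‖ ^ 2 * u k / 2) := by
    filter_upwards [hW.ae_stoppedValue_confClock_mem hD hf hU hUb hUD hx₀] with ω hω j k
    simp only [hE, norm_stoppedValue_confExp]
    obtain ⟨h0, h1⟩ := hω (u k)
    constructor
    · exact Real.one_le_exp (by positivity)
    · gcongr
  -- the product `Π n` and the weight `Π n / E n n`
  set Pr : ℕ → Ω → ℂ := fun n ω ↦ ∏ j ∈ Finset.range n, E j (j + 1) ω / E j j ω with hPr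
  set B : ℕ → ℝ := fun n ↦ ∏ j ∈ Finset.range n, Real.exp (‖θ j‖ ^ 2 * u (j + 1) / 2) with hB
  have hPrm : ∀ n, Measurable[(hτ n).measurableSpace] (Pr n) := fun n ↦ by
    refine Finset.measurable_prod _ fun j hj ↦ ?_
    rw [Finset.mem_range] at hj
    exact (hEm j (j + 1) n hj).div (hEm j j n hj.le)
  have hPrb : ∀ᵐ ω ∂P, ∀ n, ‖Pr n ω‖ ≤ B n := by
    filter_upwards [hbd] with ω hω n
    simp only [hPr, hB]
    rw [norm_prod]
    refine Finset.prod_le_prod (fun j _ ↦ norm_nonneg _) fun j _ ↦ ?_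
    rw [norm_div]
    calc ‖E j (j + 1) ω‖ / ‖E j j ω‖ ≤ ‖E j (j + 1) ω‖ / 1 :=
          div_le_div_of_nonneg_left (norm_nonneg _) one_pos (hω j j).1
      _ ≤ Real.exp (‖θ j‖ ^ 2 * u (j + 1) / 2) := by rw [div_one]; exact (hω j (j + 1)).2
  have hPri : ∀ n, Integrable (Pr n) P := fun n ↦
    ⟨((hPrm n).mono (hτ n).measurableSpace_le le_rfl).aestronglyMeasurable,
      HasFiniteIntegral.of_bounded (hPrb.mono fun ω hω ↦ hω n)⟩
  -- induction
  suffices h : ∫ ω, Pr n ω ∂P = 1 from ⟨hPri n, h⟩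
  induction n with
  | zero => simp [hPr]
  | succ n ih =>
    -- `Pr (n+1) = (Pr n / E n n) * E n (n+1)`
    set G : Ω → ℂ := fun ω ↦ Pr n ω / E n n ω with hG
    have hGm : Measurable[(hτ n).measurableSpace] G := (hPrm n).div (hEm n n n le_rfl)
    have hGb : ∀ᵐ ω ∂P, ‖G ω‖ ≤ B n := by
      filter_upwards [hPrb, hbd] with ω h1 h2
      simp only [hG]
      rw [norm_div]
      calc ‖Pr n ω‖ / ‖E n n ω‖ ≤ ‖Pr n ω‖ / 1 := div_le_div_of_nonneg_left (norm_nonneg _) one_pos (h2 n n).1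
        _ ≤ B n := by rw [div_one]; exact h1 n
    have hstep := hW.integral_mul_confExp_clockInv_eq hD hf hU hUb hUD hx₀ (θ n) (hu (Nat.le_succ n))
      hGm.aestronglyMeasurable hGb
    have e1 : ∀ ω, Pr (n + 1) ω = G ω * E n (n + 1) ω := fun ω ↦ by
      simp only [hPr, hG, Finset.prod_range_succ]
      ring
    have e2 : ∀ ω, G ω * E n n ω = Pr n ω := fun ω ↦ by
      have : E n n ω ≠ 0 := confExp_ne_zero (θ n) _ ω
      show Pr n ω / E n n ω * E n n ω = Pr n ω
      field_simp
    simp_rw [e1]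
    rw [hstep]
    show ∫ ω, G ω * E n n ω ∂P = 1
    simp_rw [e2]
    exact ih

end DDS

end IsBrownianVec

end Literature.Probability.Process

end
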